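import Literature.MathematicalPhysics.QuantumLattice.HubbardDysonDeterminant
import Literature.MathematicalPhysics.QuantumLattice.HubbardFermiLiquid
import Literature.MathematicalPhysics.QuantumLattice.HubbardGaugeBound
import Literature.MathematicalPhysics.QuantumLattice.FermionicTreeExpansion
import Literature.MathematicalPhysics.QuantumLattice.OrderedIntegralShuffle
import Literature.Probability.LatticeModels.CumulantRecursion
import Mathlib.Analysis.Normed.Ring.InfiniteSum
import Mathlib.Data.Finset.Option
import HarnessLib

/-!
# The linked-cluster theorem for the Hubbard two-point function (finite volume)

Topic `MathematicalPhysics/QuantumLattice`; programme under the tree's fact `bgm_two_point_limit`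
(`HubbardFermiLiquid.lean`; Benfatto–Giuliani–Mastropietro, Ann. Henri Poincaré 7 (2006) 809).
`HubbardDysonDeterminant.lean` gives BGM's (2.8)/(2.6) at the operator level: on any finite graph
`Tr(e^{-β(H(t,U)-μN)} c†_{xσ}c_{yσ'}) = Σ_k U^k a_k` and `Tr e^{-β(H(t,U)-μN)} = Σ_k U^k b_k` with
`a_k = (-β)^k ∫_{Δ_k} Σ_{x⃗} Z₀ det G_k`, `b_k = (-β)^k ∫_{Δ_k} Σ_{x⃗} Z₀ det G'_k` (determinants of
time-ordered free propagators between the creation/annihilation pairs of the words). This file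
passes to the RATIO — the thermal two-point function `⟨c†_{xσ}c_{yσ'}⟩` of the fact — by the
linked-cluster theorem in the form used in constructive fermionic theory (BGM 2006 §2.2,
(2.13)–(2.16); Mastropietro 2008 §2.3–2.4, (2.32)–(2.40): the Schwinger functions are sums of
TRUNCATED expectations `𝓔ᵀ`, with the fermionic signs kept inside determinants):

* `twoPointUrsell` — `𝓔ᵀ(c†_{xσ}c_{yσ'}; n_{x₁↑}n_{x₁↓}(s₁); …; n_{x_j↑}n_{x_j↓}(s_j))`, the Ursell
  function (`UrsellInversion.ursellOf`) over the clusters {external pair, vertices} of the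
  determinant moments (`FermionicTreeExpansion.moment`) of the propagator matrix
  (`twoPointPropMatrix`, `propMatrix`; clusters `hubbardCluster`);
* `det_twoPointPropMatrix_eq_sum` — **block decomposition** of the order-`k` determinant:
  `det G_k(x⃗,s) = Σ_{S ⊆ [k]} 𝓔ᵀ_{|S|}(x⃗|_S, s|_S) · det G'_{|Sᶜ|}(x⃗|_{Sᶜ}, s|_{Sᶜ})`
  (`sum_ursellOf_mul_eq` at the external cluster, transported through the functoriality of the
  moments under re-indexing of fields and clusters, `FermionicTree.moment_map_eq`);
* `twoPointIntegrand_eq_sum`, `hubbardTwoPointCoeff_eq_sum_antidiagonal` — factorising the vertex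
  sums (`sum_tupleOn_mul_tupleOn`) and the ordered time integrals (the shuffle product
  `orderedIntegral_sum_tupleOn_mul` of `OrderedIntegralShuffle.lean`): **`a_k = Σ_{j+m=k} t_j b_m`**
  with the truncated coefficients `t_j = hubbardTruncatedCoeff = (-β)^j ∫_{Δ_j} Σ_{x⃗} 𝓔ᵀ_j`;
* `hubbardTruncatedCoeff_zero` — `t₀ = ⟨c†_{xσ}c_{yσ'}⟩₀ = [(1+e^{βh})⁻¹]_{(y,σ'),(x,σ)}` (check of
  conventions); `summable_norm_hubbardVacuumCoeff` — `Σ ‖U^m b_m‖ < ∞` (Dyson series);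
* **`thermalCorr_hubbard_eq_tsum_truncated`** — for real `U` at which `Σ ‖U^j t_j‖ < ∞`:
  `⟨c†_{xσ}c_{yσ'}⟩_{β,H(t,U)-μN} = Σ_j U^j t_j` (Cauchy product and `Z > 0`);
  **`hubbardThermalTwoPoint_eq_tsum_truncated`** — the same for the torus two-point function of
  `bgm_two_point_limit`.

What is NOT here: any bound on `t_j` — the radius of absolute convergence, uniformly in the
volume, is the content of the Gram–Hadamard / tree-expansion estimates
(`FermionicTreeExpansion*.lean`, BGM (2.66), (2.77)) and of BGM's multiscale analysis (§2.2–§3).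
Everything is PROVED; the definitions are the propagator matrices, cluster maps, re-indexing maps
and the coefficient integrands.

## References

* G. Benfatto, A. Giuliani, V. Mastropietro, Ann. Henri Poincaré 7 (2006) 809–898, §2.1 (2.6)–(2.8),
  §2.2 (2.13)–(2.16) (arXiv:cond-mat/0507686, pp. 5–6). [BenfattoGiulianiMastropietro2006]
* V. Mastropietro, *Non-Perturbative Renormalization* (World Scientific 2008), §2.3–2.4
  (2.32)–(2.40) (truncated expectations and Schwinger functions). [Mastropietro2008]
* D. Ruelle, *Statistical Mechanics: Rigorous Results* (Benjamin 1969), §4.4 (Ursell functions).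
  [Ruelle1969]
* D. C. Brydges, *A short course on cluster expansions*, Les Houches 1984 (1986), §2. [Brydges1986]
-/

noncomputable section

open scoped Matrix.Norms.L2Operator ComplexOrder
open Finset MeasureTheory intervalIntegral Filter Topology NormedSpace
open Literature.Probability.LatticeModels (ursellOf)

/-! ### Functoriality of the determinant moments -/

namespace Literature.MathematicalPhysics.QuantumLattice.FermionicTree

variable {ι : Type*} [DecidableEq ι] {F : Type*} [Fintype F] [LinearOrder F] {R : Type*} [CommRing R]

/-- **The moment of all clusters is the full determinant**: `moment c G univ = det G`. [folklore] -/
theorem moment_univ [Fintype ι] (c : F → ι) (G : Matrix F F R) :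
    moment c G (Finset.univ : Finset ι) = G.det := by
  have hcard : (fieldsOf c (Finset.univ : Finset ι)).card = Fintype.card F := by
    simp [fieldsOf]
  have hbij : Function.Bijective (enum c (Finset.univ : Finset ι)) := by
    rw [Fintype.bijective_iff_injective_and_card]
    exact ⟨(enum c _).injective, by rw [Fintype.card_fin, hcard]⟩
  exact Matrix.det_submatrix_equiv_self (Equiv.ofBijective _ hbij) G

/-- The fields of the clusters `φ(Q')` are the `ψ`-images of the fields of `Q'`, for a compatible
pair of embeddings (fields `ψ`, clusters `φ`). [folklore] -/
theorem fieldsOf_map_eq {ι' F' : Type*} [DecidableEq ι'] [Fintype F'] [LinearOrder F']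
    (c : F → ι) (c' : F' → ι') (ψ : F' ↪o F) (φ : ι' ↪ ι)
    (hc : ∀ a', c (ψ a') = φ (c' a')) (hrange : ∀ a, c a ∈ Set.range φ → a ∈ Set.range ψ)
    (Q' : Finset ι') : fieldsOf c (Q'.map φ) = (fieldsOf c' Q').map ψ.toEmbedding := by
  ext a
  simp only [mem_fieldsOf, Finset.mem_map, RelEmbedding.coe_toEmbedding]
  constructor
  · rintro ⟨q, hq, hqa⟩
    obtain ⟨a', rfl⟩ := hrange a ⟨q, hqa⟩
    refine ⟨a', ?_, rfl⟩
    rw [hc] at hqa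
    rwa [← φ.injective hqa]
  · rintro ⟨a', ha', rfl⟩
    exact ⟨c' a', ha', (hc a').symm⟩

/-- **Functoriality of the moments**: for an order embedding of fields `ψ : F' ↪o F` over an
embedding of clusters `φ : ι' ↪ ι` (`c ∘ ψ = φ ∘ c'`, and every field of a cluster in the range
of `φ` is in the range of `ψ`), the moments of `φ(Q')` for `G` are the moments of `Q'` for the
restricted propagator matrix `G|_{ψ}`. [folklore] -/
theorem moment_map_eq {ι' F' : Type*} [DecidableEq ι'] [Fintype F'] [LinearOrder F']
    (c : F → ι) (G : Matrix F F R) (c' : F' → ι') (ψ : F' ↪o F) (φ : ι' ↪ ι)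
    (hc : ∀ a', c (ψ a') = φ (c' a')) (hrange : ∀ a, c a ∈ Set.range φ → a ∈ Set.range ψ)
    (Q' : Finset ι') : moment c G (Q'.map φ) = moment c' (G.submatrix ψ ψ) Q' := by
  have hF := fieldsOf_map_eq c c' ψ φ hc hrange Q'
  have hn : (fieldsOf c (Q'.map φ)).card = (fieldsOf c' Q').card := by rw [hF, Finset.card_map]
  -- the enumeration of the fields of `φ(Q')` is `ψ ∘` (that of `Q'`), up to the cast
  have hg : (fun i : Fin (fieldsOf c (Q'.map φ)).card => ψ (enum c' Q' (Fin.cast hn i))) =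
      enum c (Q'.map φ) := by
    refine Finset.orderEmbOfFin_unique rfl (fun i => ?_) (fun a b hab => ?_)
    · have hm := Finset.mem_map_of_mem ψ.toEmbedding
        ((fieldsOf c' Q').orderEmbOfFin_mem rfl (Fin.cast hn i))
      rw [← hF] at hm
      exact hm
    · exact ψ.strictMono ((enum c' Q').strictMono hab)
  have hM : G.submatrix (enum c (Q'.map φ)) (enum c (Q'.map φ)) =
      ((G.submatrix ψ ψ).submatrix (enum c' Q') (enum c' Q')).submatrix (Fin.cast hn) (Fin.cast hn) := by
    ext a b
    have ha : ψ (enum c' Q' (Fin.cast hn a)) = enum c (Q'.map φ) a := congrFun hg a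
    have hb : ψ (enum c' Q' (Fin.cast hn b)) = enum c (Q'.map φ) b := congrFun hg b
    rw [Matrix.submatrix_apply, Matrix.submatrix_apply, Matrix.submatrix_apply,
      Matrix.submatrix_apply, ← ha, ← hb]
  unfold moment
  rw [hM]
  exact Matrix.det_submatrix_equiv_self (finCongr hn) _

/-- **Ursell functions of the moments are functorial** in the same sense. [folklore] -/
theorem ursellOf_moment_map_eq {ι' F' : Type*} [DecidableEq ι'] [Fintype F'] [LinearOrder F']
    (c : F → ι) (G : Matrix F F R) (c' : F' → ι') (ψ : F' ↪o F) (φ : ι' ↪ ι)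
    (hc : ∀ a', c (ψ a') = φ (c' a')) (hrange : ∀ a, c a ∈ Set.range φ → a ∈ Set.range ψ)
    (Q' : Finset ι') :
    Literature.Probability.LatticeModels.ursellOf (moment c G) (Q'.map φ) =
      Literature.Probability.LatticeModels.ursellOf (moment c' (G.submatrix ψ ψ)) Q' := by
  rw [← Literature.Probability.LatticeModels.ursellOf_map φ (moment c G) Q']
  congr 1
  funext P
  exact moment_map_eq c G c' ψ φ hc hrange P

/-- **Continuity of Ursell functions**: if all moments depend continuously on a parameter, so do
their Ursell functions (finite Möbius recursion). [folklore] -/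
theorem continuous_ursellOf {X : Type*} [TopologicalSpace X] {α : Type*} [DecidableEq α]
    {C : Type*} [CommRing C] [TopologicalSpace C] [IsTopologicalRing C]
    (m : X → Finset α → C) (hm : ∀ P, Continuous fun x => m x P) (V : Finset α) :
    Continuous fun x => Literature.Probability.LatticeModels.ursellOf (m x) V := by
  induction V using Finset.strongInduction with
  | H V ih =>
    have hfun : (fun x => Literature.Probability.LatticeModels.ursellOf (m x) V) = fun x =>
        m x V - ∑ π ∈ (Literature.Probability.LatticeModels.setPartitions V).erase {V},
          ∏ P ∈ π, Literature.Probability.LatticeModels.ursellOf (m x) P := by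
      funext x; exact Literature.Probability.LatticeModels.ursellOf_eq (m x) V
    rw [hfun]
    refine (hm V).sub (continuous_finsetSum _ fun π hπ => continuous_finsetProd _ fun P hP => ?_)
    obtain ⟨hne, hπ'⟩ := Finset.mem_erase.1 hπ
    exact ih P ((Literature.Probability.LatticeModels.mem_setPartitions.1 hπ').ssubset_of_ne_singleton
      hne hP)

/-- Continuity of the moments in a parameter, from continuity of the propagator matrix entries.
[folklore] -/
theorem continuous_moment {X : Type*} [TopologicalSpace X] {C : Type*} [CommRing C]
    [TopologicalSpace C] [IsTopologicalRing C] (c : F → ι) (G : X → Matrix F F C)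
    (hG : ∀ a b, Continuous fun x => G x a b) (Q : Finset ι) :
    Continuous fun x => moment c (G x) Q := by
  unfold moment
  refine Continuous.matrix_det ?_
  exact continuous_matrix fun i j => hG _ _

end Literature.MathematicalPhysics.QuantumLattice.FermionicTree

namespace Literature.MathematicalPhysics.QuantumLattice

/-! ### Splitting tuples along a subset of the indices -/

section TupleSplit

variable {X : Type*} {n : ℕ}

/-- **Splitting a tuple into its sub-tuples on `S` and on `Sᶜ`** is a bijection
`(Fin n → X) ≃ (Fin |S| → X) × (Fin |Sᶜ| → X)`. [folklore] -/
def tupleSplitEquiv (S : Finset (Fin n)) {j m : ℕ} (h : S.card = j) (h' : Sᶜ.card = m)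
    (X : Type*) : (Fin n → X) ≃ (Fin j → X) × (Fin m → X) where
  toFun u := (tupleOn S h u, tupleOn Sᶜ h' u)
  invFun p i := if hi : i ∈ S then p.1 ((S.orderIsoOfFin h).symm ⟨i, hi⟩)
    else p.2 ((Sᶜ.orderIsoOfFin h').symm ⟨i, Finset.mem_compl.2 hi⟩)
  left_inv u := by
    funext i
    by_cases hi : i ∈ S
    · simp only [hi, dif_pos, tupleOn_apply]
      rw [← Finset.coe_orderIsoOfFin_apply, OrderIso.apply_symm_apply]
    · simp only [hi, dif_neg, not_false_eq_true, tupleOn_apply]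
      rw [← Finset.coe_orderIsoOfFin_apply, OrderIso.apply_symm_apply]
  right_inv p := by
    ext i
    · simp only [tupleOn_apply]
      rw [dif_pos (S.orderEmbOfFin_mem h i)]
      have hx : (S.orderIsoOfFin h).symm ⟨S.orderEmbOfFin h i, S.orderEmbOfFin_mem h i⟩ = i := by
        rw [OrderIso.symm_apply_eq]
        exact Subtype.ext (Finset.coe_orderIsoOfFin_apply S h i).symm
      rw [hx]
    · simp only [tupleOn_apply]
      have hi : Sᶜ.orderEmbOfFin h' i ∉ S := Finset.mem_compl.1 (Sᶜ.orderEmbOfFin_mem h' i)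
      rw [dif_neg hi]
      have hx : (Sᶜ.orderIsoOfFin h').symm ⟨Sᶜ.orderEmbOfFin h' i, Finset.mem_compl.2 hi⟩ = i := by
        rw [OrderIso.symm_apply_eq]
        exact Subtype.ext (Finset.coe_orderIsoOfFin_apply Sᶜ h' i).symm
      rw [hx]

/-- The components of the splitting are the sub-tuples. [folklore] -/
@[simp] theorem tupleSplitEquiv_apply (S : Finset (Fin n)) {j m : ℕ} (h : S.card = j)
    (h' : Sᶜ.card = m) (u : Fin n → X) :
    tupleSplitEquiv S h h' X u = (tupleOn S h u, tupleOn Sᶜ h' u) := rfl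

/-- **Sums over tuples factorise along the splitting**:
`Σ_u Φ(u|_S) Ψ(u|_{Sᶜ}) = (Σ_v Φ v)(Σ_w Ψ w)`. [folklore] -/
theorem sum_tupleOn_mul_tupleOn [Fintype X] {R : Type*} [CommSemiring R] (S : Finset (Fin n))
    {j m : ℕ} (h : S.card = j) (h' : Sᶜ.card = m) (Φ : (Fin j → X) → R) (Ψ : (Fin m → X) → R) :
    ∑ u : Fin n → X, Φ (tupleOn S h u) * Ψ (tupleOn Sᶜ h' u) =
      (∑ v : Fin j → X, Φ v) * ∑ w : Fin m → X, Ψ w := by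
  classical
  rw [← (tupleSplitEquiv S h h' X).symm.sum_comp, Fintype.sum_prod_type, Finset.sum_mul_sum]
  refine Finset.sum_congr rfl fun v _ => Finset.sum_congr rfl fun w _ => ?_
  have := (tupleSplitEquiv S h h' X).apply_symm_apply (v, w)
  rw [tupleSplitEquiv_apply, Prod.mk.injEq] at this
  rw [this.1, this.2]

end TupleSplit

/-! ### The pair-indexed matrix of time-ordered free propagators -/

section PropMatrix

variable {κ : Type*} [Fintype κ] [DecidableEq κ]

/-- **The matrix of time-ordered free propagators between creation/annihilation pairs.** For a
one-body matrix `h`, inverse temperature `β`, and pairs `a ∈ P` (linearly ordered) carrying a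
creation orbital `op a`, an annihilation orbital `om a` and a (complex) time `τ a`, the entry
`(a, b)` is `[e^{-τ_b h}(1+e^{βh})⁻¹e^{τ_a h}]_{om b, op a}` if `a ≤ b` (creation of pair `a` to the
left of the annihilation of pair `b`) and `-[e^{-τ_b h}(1+e^{-βh})⁻¹e^{τ_a h}]_{om b, op a}`
otherwise — the free propagator of BGM (1.3)–(1.4) in finite volume, as it appears in the
determinants of `HubbardDysonDeterminant`. [cite: BenfattoGiulianiMastropietro2006, §1.2 (1.4)] -/
def propMatrix (β : ℝ) (h : Matrix κ κ ℂ) {n : ℕ} (op om : Fin n → κ)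
    (τ : Fin n → ℂ) : Matrix (Fin n) (Fin n) ℂ :=
  Matrix.of fun a b : Fin n =>
    if a ≤ b then
      (exp (-(τ b • h)) * (1 + exp ((β : ℂ) • h))⁻¹ * exp (τ a • h)) (om b) (op a)
    else
      -(exp (-(τ b • h)) * (1 + exp (-((β : ℂ) • h)))⁻¹ * exp (τ a • h)) (om b) (op a)

/-- **Restriction along an order embedding of the pairs relabels the propagator matrix.**
[folklore] -/
theorem propMatrix_submatrix (β : ℝ) (h : Matrix κ κ ℂ) {n n' : ℕ}
    (op om : Fin n → κ) (τ : Fin n → ℂ) (e : Fin n' ↪o Fin n) :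
    (propMatrix β h op om τ).submatrix e e = propMatrix β h (op ∘ e) (om ∘ e) (τ ∘ e) := by
  ext a b
  simp only [Matrix.submatrix_apply, propMatrix, Matrix.of_apply, e.le_iff_le, Function.comp_apply]

/-- The entries of the propagator matrix depend continuously on the times. [folklore] -/
theorem continuous_propMatrix_apply (β : ℝ) (h : Matrix κ κ ℂ) {n : ℕ}
    (op om : Fin n → κ) {X : Type*} [TopologicalSpace X] (τ : X → Fin n → ℂ)
    (hτ : ∀ a, Continuous fun x => τ x a) (a b : Fin n) :
    Continuous fun x => propMatrix β h op om (τ x) a b := by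
  letI : NormedAlgebra ℚ (Matrix κ κ ℂ) := .restrictScalars ℚ ℂ _
  simp only [propMatrix, Matrix.of_apply]
  have h1 : Continuous fun x => exp (-(τ x b • h)) * (1 + exp ((β : ℂ) • h))⁻¹ * exp (τ x a • h) :=
    ((exp_continuous.comp ((hτ b).smul continuous_const).neg).mul continuous_const).mul
      (exp_continuous.comp ((hτ a).smul continuous_const))
  have h2 : Continuous fun x => -(exp (-(τ x b • h)) * (1 + exp (-((β : ℂ) • h)))⁻¹ * exp (τ x a • h)) :=
    (((exp_continuous.comp ((hτ b).smul continuous_const).neg).mul continuous_const).mul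
      (exp_continuous.comp ((hτ a).smul continuous_const))).neg
  split_ifs
  · exact (continuous_apply _).comp ((continuous_apply _).comp h1) |>.congr fun x => rfl
  · exact (continuous_apply _).comp ((continuous_apply _).comp h2) |>.congr fun x => rfl

end PropMatrix

end Literature.MathematicalPhysics.QuantumLattice

namespace Literature.MathematicalPhysics.QuantumLattice

/-! ### Clusters and field re-indexing for the Hubbard words -/

section Clusters

/-- **The cluster map of the two-point word** `c†_{xσ}c_{yσ'} ∏_i n_{x_i↑}(s_i) n_{x_i↓}(s_i)`:
position `0` (the external pair) belongs to the external cluster `none`, position `1 + 2i + j`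
(the `j`-spin pair of vertex `i`) to the vertex cluster `some i`. [folklore] -/
def hubbardCluster (k : ℕ) : Fin (k * 2 + 1) → Option (Fin k) :=
  Fin.cons none fun m => some (finProdFinEquiv.symm m).1

/-- The external pair belongs to the external cluster. [folklore] -/
@[simp] theorem hubbardCluster_zero (k : ℕ) : hubbardCluster k 0 = none := rfl

/-- The pairs of vertex `i` belong to cluster `some i`. [folklore] -/
@[simp] theorem hubbardCluster_succ (k : ℕ) (m : Fin (k * 2)) :
    hubbardCluster k m.succ = some (finProdFinEquiv.symm m).1 := by
  simp [hubbardCluster]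

/-- **The cluster map of the vacuum word** `∏_i n_{x_i↑}(s_i) n_{x_i↓}(s_i)`: position `2i + j`
belongs to vertex `i`. [folklore] -/
def vacuumCluster (m : ℕ) : Fin (m * 2) → Fin m := fun p => (finProdFinEquiv.symm p).1

variable {j k : ℕ}

/-- Re-indexing vertex pairs along a map of vertices: `(i, r) ↦ (e i, r)`. [folklore] -/
def pairMap (e : Fin j → Fin k) (m : Fin (j * 2)) : Fin (k * 2) :=
  finProdFinEquiv (e (finProdFinEquiv.symm m).1, (finProdFinEquiv.symm m).2)

/-- Components of a re-indexed pair. [folklore] -/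
theorem finProdFinEquiv_symm_pairMap (e : Fin j → Fin k) (m : Fin (j * 2)) :
    finProdFinEquiv.symm (pairMap e m) = (e (finProdFinEquiv.symm m).1, (finProdFinEquiv.symm m).2) := by
  simp [pairMap]

/-- The vertex of a re-indexed pair. [folklore] -/
@[simp] theorem divNat_pairMap (e : Fin j → Fin k) (m : Fin (j * 2)) :
    (pairMap e m).divNat = e m.divNat := by
  have h := finProdFinEquiv_symm_pairMap e m
  rw [finProdFinEquiv_symm_apply, finProdFinEquiv_symm_apply, Prod.mk.injEq] at h
  exact h.1

/-- The spin of a re-indexed pair. [folklore] -/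
@[simp] theorem modNat_pairMap (e : Fin j → Fin k) (m : Fin (j * 2)) :
    (pairMap e m).modNat = m.modNat := by
  have h := finProdFinEquiv_symm_pairMap e m
  rw [finProdFinEquiv_symm_apply, finProdFinEquiv_symm_apply, Prod.mk.injEq] at h
  exact h.2

/-- The value of a re-indexed pair: `(pairMap e m : ℕ) = m % 2 + 2 e(m / 2)`. [folklore] -/
theorem val_pairMap (e : Fin j → Fin k) (m : Fin (j * 2)) :
    (pairMap e m : ℕ) = (m : ℕ) % 2 + 2 * (e (finProdFinEquiv.symm m).1 : ℕ) := by
  simp [pairMap, finProdFinEquiv, Fin.coe_modNat]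

/-- Re-indexing pairs along a strictly monotone map of vertices is strictly monotone. [folklore] -/
theorem pairMap_strictMono {e : Fin j → Fin k} (he : StrictMono e) : StrictMono (pairMap e) := by
  intro a b hab
  rw [Fin.lt_def, val_pairMap, val_pairMap]
  have hab' : (a : ℕ) < b := hab
  have hdiv : (a : ℕ) / 2 ≤ (b : ℕ) / 2 := Nat.div_le_div_right hab'.le
  have h1 : ((finProdFinEquiv.symm a).1 : ℕ) = (a : ℕ) / 2 := by simp [finProdFinEquiv, Fin.coe_divNat]
  have h2 : ((finProdFinEquiv.symm b).1 : ℕ) = (b : ℕ) / 2 := by simp [finProdFinEquiv, Fin.coe_divNat]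
  rcases hdiv.lt_or_eq with hlt | heq
  · have hlt' : (finProdFinEquiv.symm a).1 < (finProdFinEquiv.symm b).1 := by
      rw [Fin.lt_def, h1, h2]; exact hlt
    have he' : (e (finProdFinEquiv.symm a).1 : ℕ) < e (finProdFinEquiv.symm b).1 := he hlt'
    omega
  · have heq' : (finProdFinEquiv.symm a).1 = (finProdFinEquiv.symm b).1 := by
      apply Fin.ext; rw [h1, h2]; exact heq
    rw [heq']
    omega

/-- **The field re-indexing of the two-point word** along a map of vertices: the external pair is
fixed, the pair `(i, r)` goes to `(e i, r)`. [folklore] -/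
def wordMap (e : Fin j → Fin k) : Fin (j * 2 + 1) → Fin (k * 2 + 1) :=
  Fin.cons 0 fun m => (pairMap e m).succ

/-- The external pair is fixed. [folklore] -/
@[simp] theorem wordMap_zero (e : Fin j → Fin k) : wordMap e 0 = 0 := rfl

/-- Vertex pairs are re-indexed. [folklore] -/
@[simp] theorem wordMap_succ (e : Fin j → Fin k) (m : Fin (j * 2)) :
    wordMap e m.succ = (pairMap e m).succ := by
  simp [wordMap]

/-- The field re-indexing is strictly monotone. [folklore] -/
theorem wordMap_strictMono {e : Fin j → Fin k} (he : StrictMono e) : StrictMono (wordMap e) := by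
  intro a b hab
  induction a using Fin.cases with
  | zero =>
    induction b using Fin.cases with
    | zero => exact absurd hab (lt_irrefl _)
    | succ b => rw [wordMap_zero, wordMap_succ]; exact Fin.succ_pos _
  | succ a =>
    induction b using Fin.cases with
    | zero => exact absurd hab (Fin.not_lt_zero _)
    | succ b =>
      rw [wordMap_succ, wordMap_succ, Fin.succ_lt_succ_iff]
      exact pairMap_strictMono he (Fin.succ_lt_succ_iff.1 hab)

/-- The field re-indexing of the two-point word as an order embedding. [folklore] -/
def wordEmb (e : Fin j ↪o Fin k) : Fin (j * 2 + 1) ↪o Fin (k * 2 + 1) :=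
  OrderEmbedding.ofStrictMono (wordMap e) (wordMap_strictMono e.strictMono)

/-- Unfolding `wordEmb`. [folklore] -/
@[simp] theorem wordEmb_apply (e : Fin j ↪o Fin k) (a : Fin (j * 2 + 1)) : wordEmb e a = wordMap e a := rfl

/-- The fields of the vacuum word of the vertices `e(Fin j)` inside the two-point word, as an order
embedding `Fin (2j) ↪o Fin (2k+1)`. [folklore] -/
def vacuumWordEmb (e : Fin j ↪o Fin k) : Fin (j * 2) ↪o Fin (k * 2 + 1) :=
  OrderEmbedding.ofStrictMono (fun m => (pairMap e m).succ) fun _ _ hab =>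
    Fin.succ_lt_succ_iff.2 (pairMap_strictMono e.strictMono hab)

/-- Unfolding `vacuumWordEmb`. [folklore] -/
@[simp] theorem vacuumWordEmb_apply (e : Fin j ↪o Fin k) (m : Fin (j * 2)) :
    vacuumWordEmb e m = (pairMap e m).succ := rfl

variable {Λ : Type*}

/-- Orbital labels under field re-indexing. [folklore] -/
theorem hubbardWordOrb_wordMap (o : Orb Λ) (f : Fin k → Λ) (e : Fin j → Fin k) (a : Fin (j * 2 + 1)) :
    hubbardWordOrb o f (wordMap e a) = hubbardWordOrb o (f ∘ e) a := by
  induction a using Fin.cases with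
  | zero => simp
  | succ m => simp

/-- Time labels under field re-indexing. [folklore] -/
theorem hubbardWordTime_wordMap (s : Fin k → ℂ) (e : Fin j → Fin k) (a : Fin (j * 2 + 1)) :
    hubbardWordTime s (wordMap e a) = hubbardWordTime (s ∘ e) a := by
  induction a using Fin.cases with
  | zero => simp
  | succ m => simp

/-- Orbital labels of re-indexed vertex pairs. [folklore] -/
theorem hubbardWordOrb_succ_pairMap (o : Orb Λ) (f : Fin k → Λ) (e : Fin j → Fin k) (m : Fin (j * 2)) :
    hubbardWordOrb o f (pairMap e m).succ =
      orb (f (e (finProdFinEquiv.symm m).1)) (finProdFinEquiv.symm m).2 := by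
  simp

/-- Time labels of re-indexed vertex pairs. [folklore] -/
theorem hubbardWordTime_succ_pairMap (s : Fin k → ℂ) (e : Fin j → Fin k) (m : Fin (j * 2)) :
    hubbardWordTime s (pairMap e m).succ = s (e (finProdFinEquiv.symm m).1) := by
  simp

/-- Cluster compatibility of the two-point re-indexing: `c_k ∘ wordMap e = Option.map e ∘ c_j`.
[folklore] -/
theorem hubbardCluster_wordMap (e : Fin j → Fin k) (a : Fin (j * 2 + 1)) :
    hubbardCluster k (wordMap e a) = Option.map e (hubbardCluster j a) := by
  induction a using Fin.cases with
  | zero => simp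
  | succ m => simp

/-- Cluster compatibility of the vacuum re-indexing: `c_k (pairMap e p).succ = some (e (c'_j p))`.
[folklore] -/
theorem hubbardCluster_succ_pairMap (e : Fin j → Fin k) (p : Fin (j * 2)) :
    hubbardCluster k (pairMap e p).succ = some (e (vacuumCluster j p)) := by
  simp [vacuumCluster]

/-- A vertex pair whose vertex is `e i` is the re-indexing of a pair of vertex `i`. [folklore] -/
theorem succ_eq_wordMap_of_eq (e : Fin j → Fin k) (m : Fin (k * 2)) (i : Fin j)
    (hi : e i = m.divNat) :
    m.succ = wordMap e (finProdFinEquiv (i, m.modNat)).succ := by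
  rw [wordMap_succ]
  congr 1
  rw [pairMap, Equiv.symm_apply_apply, hi, ← finProdFinEquiv_symm_apply, Equiv.apply_symm_apply]

/-- Range condition of the two-point re-indexing: a field whose cluster is in the range of
`Option.map e` is in the range of `wordMap e`. [folklore] -/
theorem mem_range_wordMap (e : Fin j ↪o Fin k) (a : Fin (k * 2 + 1))
    (ha : hubbardCluster k a ∈ Set.range (e.toEmbedding.optionMap)) : a ∈ Set.range (wordEmb e) := by
  induction a using Fin.cases with
  | zero => exact ⟨0, rfl⟩
  | succ m =>
    obtain ⟨o, ho⟩ := ha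
    rw [Function.Embedding.optionMap_apply, hubbardCluster_succ] at ho
    cases o with
    | none => simp at ho
    | some i =>
      simp only [Option.map_some, Option.some.injEq, RelEmbedding.coe_toEmbedding] at ho
      exact ⟨(finProdFinEquiv (i, m.modNat)).succ, (succ_eq_wordMap_of_eq e m i ho).symm⟩

/-- Range condition of the vacuum re-indexing. [folklore] -/
theorem mem_range_vacuumWordEmb (e : Fin j ↪o Fin k) (a : Fin (k * 2 + 1))
    (ha : hubbardCluster k a ∈ Set.range (e.toEmbedding.trans Function.Embedding.some)) :
    a ∈ Set.range (vacuumWordEmb e) := by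
  induction a using Fin.cases with
  | zero =>
    obtain ⟨i, hi⟩ := ha
    simp at hi
  | succ m =>
    obtain ⟨i, hi⟩ := ha
    simp only [Function.Embedding.trans_apply, Function.Embedding.some_apply, hubbardCluster_succ,
      Option.some.injEq, RelEmbedding.coe_toEmbedding] at hi
    refine ⟨finProdFinEquiv (i, m.modNat), ?_⟩
    rw [vacuumWordEmb_apply, ← wordMap_succ]
    exact (succ_eq_wordMap_of_eq e m i hi).symm

/-- The clusters of the external pair and of the vertices of `S`, i.e. `insertNone S`, are the
image of all clusters of the `|S|`-vertex word under `Option.map` of the enumeration of `S`.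
[folklore] -/
theorem insertNone_eq_map_optionMap (S : Finset (Fin k)) {j : ℕ} (h : S.card = j) :
    insertNone S = (Finset.univ : Finset (Option (Fin j))).map (S.orderEmbOfFin h).toEmbedding.optionMap := by
  ext o
  cases o with
  | none => simp
  | some v =>
    simp only [some_mem_insertNone, Finset.mem_map, Finset.mem_univ, true_and,
      Function.Embedding.optionMap_apply]
    constructor
    · intro hv
      have hv' : v ∈ Set.range (S.orderEmbOfFin h) := by rw [Finset.range_orderEmbOfFin]; exact hv
      obtain ⟨i, rfl⟩ := hv'
      exact ⟨some i, rfl⟩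
    · rintro ⟨o, ho⟩
      cases o with
      | none => simp at ho
      | some i =>
        simp only [Option.map_some, Option.some.injEq, RelEmbedding.coe_toEmbedding] at ho
        rw [← ho]
        exact Finset.orderEmbOfFin_mem S h i

/-- The remaining clusters — the vertices outside `S` — are the image of the vertices of the
`|Sᶜ|`-vertex vacuum word. [folklore] -/
theorem univ_sdiff_insertNone_eq_map (S : Finset (Fin k)) {m : ℕ} (h : Sᶜ.card = m) :
    (Finset.univ : Finset (Option (Fin k))) \ insertNone S =
      (Finset.univ : Finset (Fin m)).map ((Sᶜ.orderEmbOfFin h).toEmbedding.trans Function.Embedding.some) := by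
  ext o
  cases o with
  | none => simp
  | some v =>
    simp only [Finset.mem_sdiff, Finset.mem_univ, some_mem_insertNone, true_and, Finset.mem_map,
      Function.Embedding.trans_apply, Function.Embedding.some_apply, Option.some.injEq,
      RelEmbedding.coe_toEmbedding]
    constructor
    · intro hv
      have hv' : v ∈ Set.range (Sᶜ.orderEmbOfFin h) := by
        rw [Finset.range_orderEmbOfFin, Finset.coe_compl]; exact hv
      obtain ⟨i, rfl⟩ := hv'
      exact ⟨i, rfl⟩
    · rintro ⟨i, rfl⟩
      exact Finset.mem_compl.1 (Finset.orderEmbOfFin_mem Sᶜ h i)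

/-- Re-indexing the blocks `P₀ ∋ none` of `Option (Fin k)` by their vertex sets:
`Σ_{none ∈ P₀} g(P₀) = Σ_{S ⊆ Fin k} g(insertNone S)`. [folklore] -/
theorem sum_filter_none_mem_eq_sum_insertNone {M : Type*} [AddCommMonoid M]
    (g : Finset (Option (Fin k)) → M) :
    ∑ P₀ ∈ (Finset.univ : Finset (Option (Fin k))).powerset.filter (fun P => none ∈ P), g P₀ =
      ∑ S : Finset (Fin k), g (insertNone S) := by
  refine Finset.sum_nbij' (fun P₀ => eraseNone P₀) (fun S => insertNone S) (fun _ _ => Finset.mem_univ _)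
    (fun S _ => ?_) (fun P₀ hP₀ => ?_) (fun S _ => eraseNone_insertNone S) (fun P₀ hP₀ => ?_)
  · simp
  · have h := (Finset.mem_filter.1 hP₀).2
    rw [insertNone_eraseNone, Finset.insert_eq_of_mem h]
  · have h := (Finset.mem_filter.1 hP₀).2
    rw [insertNone_eraseNone, Finset.insert_eq_of_mem h]

end Clusters

end Literature.MathematicalPhysics.QuantumLattice

namespace Literature.MathematicalPhysics.QuantumLattice

/-! ### The propagator matrices of the Hubbard words and the truncated coefficients -/

section Coefficients

variable {Λ : Type*} [LinearOrder Λ] [Fintype Λ]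

/-- **The `(2k+1)×(2k+1)` propagator matrix of the two-point word**
`c†_{xσ}c_{yσ'} ∏_i n_{x_i↑}(s_i)n_{x_i↓}(s_i)` (the matrix whose determinant is the order-`k` free
expectation in `hasSum_hubbard_twoPoint_det`): creation orbitals `hubbardWordOrb ox f`,
annihilation orbitals `hubbardWordOrb oy f`, times `hubbardWordTime s`. BGM 2006 (2.8).
[cite: BenfattoGiulianiMastropietro2006, §2.1 (2.8)] -/
def twoPointPropMatrix (β : ℝ) (h : Matrix (Orb Λ) (Orb Λ) ℂ) (ox oy : Orb Λ) {k : ℕ}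
    (f : Fin k → Λ) (s : Fin k → ℂ) : Matrix (Fin (k * 2 + 1)) (Fin (k * 2 + 1)) ℂ :=
  propMatrix β h (hubbardWordOrb ox f) (hubbardWordOrb oy f) (hubbardWordTime s)

/-- **The `2m×2m` propagator matrix of the vacuum word** `∏_i n_{x_i↑}(s_i)n_{x_i↓}(s_i)` (the
matrix of `hasSum_hubbard_partitionFn_det`). BGM 2006 (2.6). [cite: BenfattoGiulianiMastropietro2006, §2.1 (2.6)] -/
def vacuumPropMatrix (β : ℝ) (h : Matrix (Orb Λ) (Orb Λ) ℂ) {m : ℕ} (f : Fin m → Λ) (s : Fin m → ℂ) :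
    Matrix (Fin (m * 2)) (Fin (m * 2)) ℂ :=
  propMatrix β h (fun p => orb (f (finProdFinEquiv.symm p).1) (finProdFinEquiv.symm p).2)
    (fun p => orb (f (finProdFinEquiv.symm p).1) (finProdFinEquiv.symm p).2)
    (fun p => s (finProdFinEquiv.symm p).1)

/-- **The truncated (connected) free expectation of the two-point word with `j` vertices**:
the Ursell function, over the clusters {external pair, vertex `1`, …, vertex `j`}, of the
determinant moments of the propagator matrix — `𝓔ᵀ(c†_{xσ}c_{yσ'}; n_{x₁↑}n_{x₁↓}(s₁); …; n_{x_j↑}n_{x_j↓}(s_j))`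
in the notation of BGM 2006 (2.14)–(2.16) / Mastropietro 2008 (2.32)–(2.40), at the level of
determinants (`FermionicTreeExpansion.moment`, `UrsellInversion.ursellOf`).
[cite: BenfattoGiulianiMastropietro2006, §2.2 (2.14)] -/
def twoPointUrsell (β : ℝ) (h : Matrix (Orb Λ) (Orb Λ) ℂ) (ox oy : Orb Λ) {j : ℕ} (f : Fin j → Λ)
    (s : Fin j → ℂ) : ℂ :=
  ursellOf (FermionicTree.moment (hubbardCluster j) (twoPointPropMatrix β h ox oy f s)) Finset.univ

variable (β : ℝ) (h : Matrix (Orb Λ) (Orb Λ) ℂ) (ox oy : Orb Λ)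

/-- Restricting the two-point propagator matrix to the fields of the external pair and of the
vertices `e(Fin j)` gives the two-point propagator matrix of the restricted labels. [folklore] -/
theorem twoPointPropMatrix_submatrix_wordEmb {j k : ℕ} (f : Fin k → Λ) (s : Fin k → ℂ)
    (e : Fin j ↪o Fin k) :
    (twoPointPropMatrix β h ox oy f s).submatrix (wordEmb e) (wordEmb e) =
      twoPointPropMatrix β h ox oy (f ∘ e) (s ∘ e) := by
  unfold twoPointPropMatrix
  rw [propMatrix_submatrix]
  have h1 : hubbardWordOrb ox f ∘ (wordEmb e) = hubbardWordOrb ox (f ∘ e) :=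
    funext fun a => hubbardWordOrb_wordMap ox f e a
  have h2 : hubbardWordOrb oy f ∘ (wordEmb e) = hubbardWordOrb oy (f ∘ e) :=
    funext fun a => hubbardWordOrb_wordMap oy f e a
  have h3 : hubbardWordTime s ∘ (wordEmb e) = hubbardWordTime (s ∘ e) :=
    funext fun a => hubbardWordTime_wordMap s e a
  rw [h1, h2, h3]

/-- Restricting the two-point propagator matrix to the fields of the vertices `e(Fin j)` gives the
vacuum propagator matrix of the restricted labels. [folklore] -/
theorem twoPointPropMatrix_submatrix_vacuumWordEmb {j k : ℕ} (f : Fin k → Λ) (s : Fin k → ℂ)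
    (e : Fin j ↪o Fin k) :
    (twoPointPropMatrix β h ox oy f s).submatrix (vacuumWordEmb e) (vacuumWordEmb e) =
      vacuumPropMatrix β h (f ∘ e) (s ∘ e) := by
  unfold twoPointPropMatrix vacuumPropMatrix
  rw [propMatrix_submatrix]
  congr 1
  · funext p; simp
  · funext p; simp
  · funext p; simp

/-- **The block (linked-cluster) decomposition of the order-`k` determinant**: peeling off the
truncated expectation of the block containing the external pair,
`det G_k(f, s) = Σ_{S ⊆ [k]} 𝓔ᵀ_{|S|}(f|_S, s|_S) · det G'_{|Sᶜ|}(f|_{Sᶜ}, s|_{Sᶜ})`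
(`UrsellInversion.sum_ursellOf_mul_eq` for the determinant moments, re-indexed through the
functoriality of the moments). BGM 2006 (2.13)–(2.16); Mastropietro 2008 (2.38)–(2.40).
[cite: BenfattoGiulianiMastropietro2006, §2.2 (2.14)-(2.16)] -/
theorem det_twoPointPropMatrix_eq_sum {k : ℕ} (f : Fin k → Λ) (s : Fin k → ℂ) :
    (twoPointPropMatrix β h ox oy f s).det =
      ∑ S : Finset (Fin k), twoPointUrsell β h ox oy (tupleOn S rfl f) (tupleOn S rfl s) *
        (vacuumPropMatrix β h (tupleOn Sᶜ rfl f) (tupleOn Sᶜ rfl s)).det := by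
  set M := twoPointPropMatrix β h ox oy f s with hM
  rw [← FermionicTree.moment_univ (hubbardCluster k) M,
    ← Literature.Probability.LatticeModels.sum_ursellOf_mul_eq (FermionicTree.moment (hubbardCluster k) M)
      (FermionicTree.moment_empty _ _) (Finset.mem_univ (none : Option (Fin k))),
    sum_filter_none_mem_eq_sum_insertNone]
  refine Finset.sum_congr rfl fun S _ => ?_
  congr 1
  · -- the block of the external pair: truncated expectation of the `|S|`-vertex word
    rw [insertNone_eq_map_optionMap S rfl,
      FermionicTree.ursellOf_moment_map_eq (hubbardCluster k) M (hubbardCluster S.card)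
        (wordEmb (S.orderEmbOfFin rfl)) ((S.orderEmbOfFin rfl).toEmbedding.optionMap)
        (fun a' => by
          rw [wordEmb_apply, hubbardCluster_wordMap, Function.Embedding.optionMap_apply]; rfl)
        (fun a ha => mem_range_wordMap _ a ha),
      hM, twoPointPropMatrix_submatrix_wordEmb]
    rfl
  · -- the remaining vertices: the vacuum moment of the `|Sᶜ|`-vertex word
    rw [univ_sdiff_insertNone_eq_map S rfl,
      FermionicTree.moment_map_eq (hubbardCluster k) M (vacuumCluster Sᶜ.card)
        (vacuumWordEmb (Sᶜ.orderEmbOfFin rfl)) ((Sᶜ.orderEmbOfFin rfl).toEmbedding.trans Function.Embedding.some)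
        (fun p => by
          rw [vacuumWordEmb_apply, hubbardCluster_succ_pairMap]; rfl)
        (fun a ha => mem_range_vacuumWordEmb _ a ha),
      FermionicTree.moment_univ, hM, twoPointPropMatrix_submatrix_vacuumWordEmb]
    rfl

/-- **The integrand of the truncated (linked) coefficient of order `j`**:
`(-β)^j Σ_{x⃗ ∈ Λ^j} 𝓔ᵀ(c†_{xσ}c_{yσ'}; n_{x₁↑}n_{x₁↓}(s₁); …)`, `s_i = -β v_i`.
[cite: BenfattoGiulianiMastropietro2006, §2.2 (2.14)] -/
def truncatedIntegrand (j : ℕ) : (Fin j → ℝ) → ℂ := fun v =>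
  (-(β : ℂ)) ^ j * ∑ g : Fin j → Λ, twoPointUrsell β h ox oy g (fun i => ((v i : ℝ) : ℂ) * -(β : ℂ))

/-- **The integrand of the vacuum coefficient of order `m`** (as in `hasSum_hubbard_partitionFn_det`):
`(-β)^m Σ_{x⃗ ∈ Λ^m} Z₀ det G'_m(x⃗, s)`, `s_i = -β w_i`. [cite: BenfattoGiulianiMastropietro2006, §2.1 (2.6)] -/
def vacuumIntegrand (Z₀ : ℂ) (m : ℕ) : (Fin m → ℝ) → ℂ := fun w =>
  (-(β : ℂ)) ^ m * ∑ g : Fin m → Λ, Z₀ * (vacuumPropMatrix β h g (fun i => ((w i : ℝ) : ℂ) * -(β : ℂ))).det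

/-- **The integrand of the full two-point coefficient of order `k`** (as in `hasSum_hubbard_twoPoint_det`):
`(-β)^k Σ_{x⃗ ∈ Λ^k} Z₀ det G_k(x⃗, s)`. [cite: BenfattoGiulianiMastropietro2006, §2.1 (2.8)] -/
def twoPointIntegrand (Z₀ : ℂ) (k : ℕ) : (Fin k → ℝ) → ℂ := fun u =>
  (-(β : ℂ)) ^ k * ∑ f : Fin k → Λ, Z₀ * (twoPointPropMatrix β h ox oy f (fun i => ((u i : ℝ) : ℂ) * -(β : ℂ))).det

/-- **The two-point integrand splits into linked and vacuum parts over the subsets of vertices**: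
`(-β)^k Σ_f Z₀ det G_k(f,u) = Σ_{S ⊆ [k]} T_{|S|}(u|_S) · B_{|Sᶜ|}(u|_{Sᶜ})`. [folklore] -/
theorem twoPointIntegrand_eq_sum (Z₀ : ℂ) {k : ℕ} (u : Fin k → ℝ) :
    twoPointIntegrand β h ox oy Z₀ k u = ∑ S : Finset (Fin k),
      truncatedIntegrand β h ox oy S.card (tupleOn S rfl u) *
        vacuumIntegrand β h Z₀ Sᶜ.card (tupleOn Sᶜ rfl u) := by
  have hk : ∀ S : Finset (Fin k), (-(β : ℂ)) ^ k = (-(β : ℂ)) ^ S.card * (-(β : ℂ)) ^ Sᶜ.card := by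
    intro S
    rw [← pow_add, Finset.card_add_card_compl, Fintype.card_fin]
  unfold twoPointIntegrand
  have step1 : ∀ f : Fin k → Λ,
      Z₀ * (twoPointPropMatrix β h ox oy f (fun i => ((u i : ℝ) : ℂ) * -(β : ℂ))).det =
        ∑ S : Finset (Fin k), Z₀ * (twoPointUrsell β h ox oy (tupleOn S rfl f)
          (tupleOn S rfl fun i => ((u i : ℝ) : ℂ) * -(β : ℂ)) *
          (vacuumPropMatrix β h (tupleOn Sᶜ rfl f)
            (tupleOn Sᶜ rfl fun i => ((u i : ℝ) : ℂ) * -(β : ℂ))).det) := by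
    intro f
    rw [det_twoPointPropMatrix_eq_sum β h ox oy, Finset.mul_sum]
  simp_rw [step1]
  rw [Finset.sum_comm, Finset.mul_sum]
  refine Finset.sum_congr rfl fun S _ => ?_
  unfold truncatedIntegrand vacuumIntegrand
  have e1 : (tupleOn S rfl fun i => ((u i : ℝ) : ℂ) * -(β : ℂ)) =
      fun i => (((tupleOn S rfl u) i : ℝ) : ℂ) * -(β : ℂ) := rfl
  have e2 : (tupleOn Sᶜ rfl fun i => ((u i : ℝ) : ℂ) * -(β : ℂ)) =
      fun i => (((tupleOn Sᶜ rfl u) i : ℝ) : ℂ) * -(β : ℂ) := rfl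
  rw [e1, e2]
  have hsplit := sum_tupleOn_mul_tupleOn (X := Λ) S rfl rfl
    (fun g : Fin S.card → Λ => twoPointUrsell β h ox oy g
      (fun i => (((tupleOn S rfl u) i : ℝ) : ℂ) * -(β : ℂ)))
    (fun g : Fin Sᶜ.card → Λ => Z₀ * (vacuumPropMatrix β h g
      (fun i => (((tupleOn Sᶜ rfl u) i : ℝ) : ℂ) * -(β : ℂ))).det)
  rw [hk S, Finset.sum_congr rfl fun (f : Fin k → Λ) _ => mul_left_comm Z₀
    (twoPointUrsell β h ox oy (tupleOn S rfl f) (fun i => (((tupleOn S rfl u) i : ℝ) : ℂ) * -(β : ℂ)))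
    ((vacuumPropMatrix β h (tupleOn Sᶜ rfl f)
      (fun i => (((tupleOn Sᶜ rfl u) i : ℝ) : ℂ) * -(β : ℂ))).det), hsplit]
  ring

end Coefficients

end Literature.MathematicalPhysics.QuantumLattice

namespace Literature.MathematicalPhysics.QuantumLattice

section Shuffle

variable {Λ : Type*} [LinearOrder Λ] [Fintype Λ]
variable (β : ℝ) (h : Matrix (Orb Λ) (Orb Λ) ℂ) (ox oy : Orb Λ)

/-- The rescaled times `s_i = -β w_i` depend continuously on `w`. [folklore] -/
theorem continuous_time_coord {m : ℕ} (i : Fin m) :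
    Continuous fun w : Fin m → ℝ => ((w i : ℝ) : ℂ) * -(β : ℂ) :=
  (Complex.continuous_ofReal.comp (continuous_apply i)).mul continuous_const

/-- The vacuum integrand is continuous. [folklore] -/
theorem continuous_vacuumIntegrand (Z₀ : ℂ) (m : ℕ) : Continuous (vacuumIntegrand β h Z₀ m) := by
  unfold vacuumIntegrand vacuumPropMatrix
  refine continuous_const.mul (continuous_finsetSum _ fun g _ => continuous_const.mul ?_)
  refine Continuous.matrix_det (continuous_matrix fun a b => ?_)
  exact continuous_propMatrix_apply β h _ _
    (τ := fun (w : Fin m → ℝ) (p : Fin (m * 2)) => ((w (finProdFinEquiv.symm p).1 : ℝ) : ℂ) * -(β : ℂ))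
    (fun p => continuous_time_coord β _) a b

/-- The time labels of the two-point word depend continuously on the times. [folklore] -/
theorem continuous_hubbardWordTime {j : ℕ} (a : Fin (j * 2 + 1)) :
    Continuous fun v : Fin j → ℝ => hubbardWordTime (fun i => ((v i : ℝ) : ℂ) * -(β : ℂ)) a := by
  induction a using Fin.cases with
  | zero => simp only [hubbardWordTime_zero]; exact continuous_const
  | succ m => simp only [hubbardWordTime_succ]; exact continuous_time_coord β _

/-- The truncated integrand is continuous. [folklore] -/
theorem continuous_truncatedIntegrand (j : ℕ) : Continuous (truncatedIntegrand β h ox oy j) := by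
  unfold truncatedIntegrand twoPointUrsell
  refine continuous_const.mul (continuous_finsetSum _ fun g _ => ?_)
  refine FermionicTree.continuous_ursellOf
    (fun (v : Fin j → ℝ) P => FermionicTree.moment (hubbardCluster j)
      (twoPointPropMatrix β h ox oy g (fun i => ((v i : ℝ) : ℂ) * -(β : ℂ))) P) (fun P => ?_) _
  refine FermionicTree.continuous_moment (hubbardCluster j) _ (fun a b => ?_) P
  unfold twoPointPropMatrix
  exact continuous_propMatrix_apply β h _ _
    (τ := fun (v : Fin j → ℝ) => hubbardWordTime (fun i => ((v i : ℝ) : ℂ) * -(β : ℂ)))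
    (fun a => continuous_hubbardWordTime β a) a b

/-- **The full two-point coefficient of order `k` is the exponential convolution of the truncated
and the vacuum coefficients**: `a_k = Σ_{j+m=k} t_j b_m` with
`a_k = ∫_{Δ_k} (-β)^k Σ Z₀ det G_k`, `t_j = ∫_{Δ_j} (-β)^j Σ 𝓔ᵀ_j`, `b_m = ∫_{Δ_m} (-β)^m Σ Z₀ det G'_m`
(block decomposition of the determinant, factorisation of the vertex sums, and the shuffle product
of the ordered time integrals). This is the combinatorial content of "numerator = (sum of connected
diagrams) × (vacuum diagrams)", BGM 2006 (2.8) with (2.13)–(2.16).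
[cite: BenfattoGiulianiMastropietro2006, §2.2 (2.14)-(2.16)] -/
theorem orderedIntegral_twoPointIntegrand_eq_sum_antidiagonal (Z₀ : ℂ) (k : ℕ) :
    orderedIntegral k (twoPointIntegrand β h ox oy Z₀ k) 1 =
      ∑ p ∈ antidiagonal k, orderedIntegral p.1 (truncatedIntegrand β h ox oy p.1) 1 *
        orderedIntegral p.2 (vacuumIntegrand β h Z₀ p.2) 1 := by
  have hfun : twoPointIntegrand β h ox oy Z₀ k = fun u => ∑ S : Finset (Fin k),
      truncatedIntegrand β h ox oy S.card (tupleOn S rfl u) *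
        vacuumIntegrand β h Z₀ Sᶜ.card (tupleOn Sᶜ rfl u) :=
    funext fun u => twoPointIntegrand_eq_sum β h ox oy Z₀ u
  rw [hfun]
  exact orderedIntegral_sum_tupleOn_mul k (truncatedIntegrand β h ox oy) (vacuumIntegrand β h Z₀)
    (continuous_truncatedIntegrand β h ox oy) (continuous_vacuumIntegrand β h Z₀) 1

end Shuffle

/-! ### The linked-cluster theorem for the Hubbard two-point function (finite volume) -/

section Hubbard

variable {Λ : Type*} [LinearOrder Λ] [Fintype Λ] (G : SimpleGraph Λ) [DecidableRel G.Adj]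

/-- **The truncated (linked-cluster) coefficient of order `j`** of the Hubbard two-point function
`⟨c†_{xσ}c_{yσ'}⟩` on a finite graph:
`t_j = (-β)^j ∫_{0≤v₀≤⋯≤v_{j-1}≤1} Σ_{x⃗ ∈ Λ^j} 𝓔ᵀ(c†_{xσ}c_{yσ'}; n_{x₁↑}n_{x₁↓}(s₁); …; n_{x_j↑}n_{x_j↓}(s_j)) dv`,
`s_i = -βv_i`, the truncated expectation being the Ursell function of the determinant moments of the
free propagator matrix (the "sum over connected Feynman graphs" with the fermionic signs kept
inside determinants). BGM 2006 §2.1–2.2, (2.8) and (2.13)–(2.16); Mastropietro 2008 (2.38)–(2.40).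
[cite: BenfattoGiulianiMastropietro2006, §2.2 (2.14)-(2.16)] -/
def hubbardTruncatedCoeff (β t μ : ℝ) (x y : Λ) (σ σ' : Fin 2) (j : ℕ) : ℂ :=
  orderedIntegral j (truncatedIntegrand β (hubbardOneBody G t μ) (orb x σ) (orb y σ') j) 1

/-- The vacuum coefficient of order `m` (the order-`m` term of `Tr e^{-β(H(t,U)-μN)}` divided by
`U^m`, in determinant form). [cite: BenfattoGiulianiMastropietro2006, §2.1 (2.6)] -/
def hubbardVacuumCoeff (β t μ : ℝ) (m : ℕ) : ℂ :=
  orderedIntegral m (vacuumIntegrand β (hubbardOneBody G t μ)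
    (Matrix.partitionFn β (dGamma (hubbardOneBody G t μ))) m) 1

/-- The full two-point coefficient of order `k` (the order-`k` term of `Tr(e^{-β(H(t,U)-μN)} c†_{xσ}c_{yσ'})`
divided by `U^k`, in determinant form). [cite: BenfattoGiulianiMastropietro2006, §2.1 (2.8)] -/
def hubbardTwoPointCoeff (β t μ : ℝ) (x y : Λ) (σ σ' : Fin 2) (k : ℕ) : ℂ :=
  orderedIntegral k (twoPointIntegrand β (hubbardOneBody G t μ) (orb x σ) (orb y σ')
    (Matrix.partitionFn β (dGamma (hubbardOneBody G t μ))) k) 1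

/-- The two-point series (numerator): `Σ_k U^k a_k = Tr(e^{-β(H(t,U)-μN)} c†_{xσ}c_{yσ'})`
(`hasSum_hubbard_twoPoint_det` in the present notation). [cite: BenfattoGiulianiMastropietro2006, §2.1 (2.8)] -/
theorem hasSum_hubbardTwoPointCoeff (β t U μ : ℝ) (x y : Λ) (σ σ' : Fin 2) :
    HasSum (fun k : ℕ => (U : ℂ) ^ k * hubbardTwoPointCoeff G β t μ x y σ σ' k)
      ((Matrix.gibbsWeight β (hamiltonianWith G t U μ) *
        (creation (orb x σ) * annihilation (orb y σ'))).trace) := by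
  refine (hasSum_hubbard_twoPoint_det G β t U μ x y σ σ').congr_fun fun k => ?_
  unfold hubbardTwoPointCoeff twoPointIntegrand twoPointPropMatrix propMatrix
  rfl

/-- The vacuum series: `Σ_m U^m b_m = Tr e^{-β(H(t,U)-μN)}` (`hasSum_hubbard_partitionFn_det`).
[cite: BenfattoGiulianiMastropietro2006, §2.1 (2.6)] -/
theorem hasSum_hubbardVacuumCoeff (β t U μ : ℝ) :
    HasSum (fun m : ℕ => (U : ℂ) ^ m * hubbardVacuumCoeff G β t μ m)
      (Matrix.partitionFn β (hamiltonianWith G t U μ)) := by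
  refine (hasSum_hubbard_partitionFn_det G β t U μ).congr_fun fun k => ?_
  unfold hubbardVacuumCoeff vacuumIntegrand vacuumPropMatrix propMatrix
  rfl

/-- **`a = t ⋆ b`**: the two-point coefficients are the Cauchy product of the truncated and the
vacuum coefficients, order by order. [cite: BenfattoGiulianiMastropietro2006, §2.2 (2.14)-(2.16)] -/
theorem hubbardTwoPointCoeff_eq_sum_antidiagonal (β t μ : ℝ) (x y : Λ) (σ σ' : Fin 2) (k : ℕ) :
    hubbardTwoPointCoeff G β t μ x y σ σ' k = ∑ p ∈ antidiagonal k,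
      hubbardTruncatedCoeff G β t μ x y σ σ' p.1 * hubbardVacuumCoeff G β t μ p.2 :=
  orderedIntegral_twoPointIntegrand_eq_sum_antidiagonal β _ _ _ _ k

end Hubbard

end Literature.MathematicalPhysics.QuantumLattice

namespace Literature.MathematicalPhysics.QuantumLattice

/-! ### Absolute convergence of the vacuum series -/

section Summable

variable {m : Type*} [Fintype m] [DecidableEq m]

/-- The Dyson series of `Tr(e^{-β(H₀+gV)} O)` converges absolutely (the trace is a bounded
functional and `Σ ‖gᵏ E_k(1)‖ < ∞`, `Matrix.summable_norm_dysonTerm`). [folklore] -/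
theorem summable_norm_dyson_trace_gibbsWeight_mul (β : ℝ) (H₀ V O : Matrix m m ℂ) (g : ℂ) :
    Summable fun k => ‖g ^ k * (Matrix.dysonTerm (-(β : ℂ) • H₀) (-(β : ℂ) • V) k 1 * O).trace‖ := by
  set L : Matrix m m ℂ →L[ℂ] ℂ :=
    LinearMap.toContinuousLinearMap ((Matrix.traceLinearMap m ℂ ℂ) ∘ₗ (LinearMap.mulRight ℂ O)) with hL
  have hLapply : ∀ X : Matrix m m ℂ, L X = (X * O).trace := fun X => rfl
  have hs := Matrix.summable_norm_dysonTerm (-(β : ℂ) • H₀) (-(β : ℂ) • V) g zero_le_one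
  refine Summable.of_nonneg_of_le (fun _ => norm_nonneg _) (fun k => ?_) (hs.mul_left ‖L‖)
  have hk : g ^ k * (Matrix.dysonTerm (-(β : ℂ) • H₀) (-(β : ℂ) • V) k 1 * O).trace =
      L (g ^ k • Matrix.dysonTerm (-(β : ℂ) • H₀) (-(β : ℂ) • V) k 1) := by
    rw [hLapply, Matrix.smul_mul, Matrix.trace_smul, smul_eq_mul]
  rw [hk]
  exact L.le_opNorm _

/-- Absolute convergence in the ordered-integral form of `hasSum_dyson_trace_gibbsWeight_sum`.
[folklore] -/
theorem summable_norm_dyson_trace_gibbsWeight_sum {R : Type*} [Fintype R] (β : ℝ)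
    (H₀ O : Matrix m m ℂ) (v : R → ℂ) (W : R → Matrix m m ℂ) (g : ℂ) :
    Summable fun k : ℕ => ‖g ^ k * orderedIntegral k (fun u : Fin k → ℝ =>
        (-(β : ℂ)) ^ k * ∑ f : Fin k → R, (∏ i, v (f i)) *
          (Matrix.gibbsWeight β H₀ * (O * (List.ofFn fun i : Fin k =>
            exp ((((u i : ℝ) : ℂ) * -(β : ℂ)) • H₀) * W (f i) *
              exp (-((((u i : ℝ) : ℂ) * -(β : ℂ)) • H₀))).prod)).trace) 1‖ := by
  have h := summable_norm_dyson_trace_gibbsWeight_mul β H₀ (∑ r, v r • W r) O g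
  refine h.congr fun k => ?_
  rw [trace_dysonTerm_mul_eq_orderedIntegral]
  exact congrArg (fun F => ‖g ^ k * orderedIntegral k F 1‖)
    (funext fun u => trace_dysonIntegrand_gibbs β H₀ O v W k u)

end Summable

section Hubbard

variable {Λ : Type*} [LinearOrder Λ] [Fintype Λ] (G : SimpleGraph Λ) [DecidableRel G.Adj]

/-- **The vacuum series `Σ_m U^m b_m = Tr e^{-β(H(t,U)-μN)}` converges absolutely** (for every
`U`; it is the Dyson series of a matrix exponential). [folklore] -/
theorem summable_norm_hubbardVacuumCoeff (β t U μ : ℝ) :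
    Summable fun k : ℕ => ‖(U : ℂ) ^ k * hubbardVacuumCoeff G β t μ k‖ := by
  haveI : Nonempty (Finset (Orb Λ)) := ⟨∅⟩
  have hZ : Matrix.partitionFn β (dGamma (hubbardOneBody G t μ)) ≠ 0 :=
    (Matrix.partitionFn_pos β (isHermitian_dGamma (isHermitian_hubbardOneBody G t μ))).ne'
  have hs := summable_norm_dyson_trace_gibbsWeight_sum β (dGamma (hubbardOneBody G t μ)) 1
    (fun _ : Λ => (1 : ℂ))
    (fun r => creation (orb r 0) * annihilation (orb r 0) * (creation (orb r 1) * annihilation (orb r 1)))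
    (U : ℂ)
  simp only [exp_mul_mul_mul_exp_neg, Finset.prod_const_one, one_mul] at hs
  refine hs.congr fun k => ?_
  unfold hubbardVacuumCoeff vacuumIntegrand vacuumPropMatrix propMatrix
  refine congrArg (fun F => ‖(U : ℂ) ^ k * orderedIntegral k F 1‖) (funext fun u => ?_)
  refine congrArg (fun S => (-(β : ℂ)) ^ k * S) (Finset.sum_congr rfl fun f _ => ?_)
  rw [← gibbsState_dGamma_prod_hubbardVertex_eq_det (isHermitian_hubbardOneBody G t μ) β f
    (fun i : Fin k => ((u i : ℝ) : ℂ) * -(β : ℂ)), Matrix.gibbsState_apply, mul_inv_cancel_left₀ hZ]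

/-- **The linked-cluster theorem for the Hubbard two-point function, numerator form**: whenever
the truncated series converges absolutely at `U`,
`(Σ_j U^j t_j) · Tr e^{-β(H(t,U)-μN)} = Tr(e^{-β(H(t,U)-μN)} c†_{xσ}c_{yσ'})`
(Cauchy product of the truncated with the vacuum series, `a = t ⋆ b`). BGM 2006 §2.1–2.2.
[cite: BenfattoGiulianiMastropietro2006, §2.2 (2.14)-(2.16)] -/
theorem tsum_hubbardTruncatedCoeff_mul_partitionFn (β t U μ : ℝ) (x y : Λ) (σ σ' : Fin 2)
    (hT : Summable fun j : ℕ => ‖(U : ℂ) ^ j * hubbardTruncatedCoeff G β t μ x y σ σ' j‖) :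
    (∑' j : ℕ, (U : ℂ) ^ j * hubbardTruncatedCoeff G β t μ x y σ σ' j) *
        Matrix.partitionFn β (hamiltonianWith G t U μ) =
      (Matrix.gibbsWeight β (hamiltonianWith G t U μ) *
        (creation (orb x σ) * annihilation (orb y σ'))).trace := by
  rw [← (hasSum_hubbardVacuumCoeff G β t U μ).tsum_eq,
    tsum_mul_tsum_eq_tsum_sum_antidiagonal_of_summable_norm hT (summable_norm_hubbardVacuumCoeff G β t U μ),
    ← (hasSum_hubbardTwoPointCoeff G β t U μ x y σ σ').tsum_eq]
  refine tsum_congr fun k => ?_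
  rw [hubbardTwoPointCoeff_eq_sum_antidiagonal, Finset.mul_sum]
  refine Finset.sum_congr rfl fun p hp => ?_
  rw [← HasAntidiagonal.mem_antidiagonal.1 hp, pow_add]
  ring

/-- **The linked-cluster theorem for the Hubbard two-point function (finite volume)**: whenever the
truncated series converges absolutely at the real coupling `U`,
`⟨c†_{xσ}c_{yσ'}⟩_{β, H(t,U)-μN} = Σ_j U^j t_j`,
`t_j = (-β)^j ∫_{Δ_j} Σ_{x⃗} 𝓔ᵀ(c†_{xσ}c_{yσ'}; n_{x₁↑}n_{x₁↓}(s₁); …; n_{x_j↑}n_{x_j↓}(s_j))` — "the two-point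
Schwinger function is the sum of the connected contributions", BGM 2006 (2.8) with (2.13)–(2.16)
(there for the Grassmann generating functional; here at the operator level in every finite volume).
The radius of absolute convergence uniform in the volume is the subject of the determinant (Gram)
bounds and of BGM's multiscale analysis, not of this file. [cite: BenfattoGiulianiMastropietro2006, §2.2 (2.14)-(2.16)] -/
theorem thermalCorr_hubbard_eq_tsum_truncated (β t U μ : ℝ) (x y : Λ) (σ σ' : Fin 2)
    (hT : Summable fun j : ℕ => ‖(U : ℂ) ^ j * hubbardTruncatedCoeff G β t μ x y σ σ' j‖) :
    Matrix.thermalCorr β (hamiltonianWith G t U μ) (creation (orb x σ)) (annihilation (orb y σ')) =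
      ∑' j : ℕ, (U : ℂ) ^ j * hubbardTruncatedCoeff G β t μ x y σ σ' j := by
  haveI : Nonempty (Finset (Orb Λ)) := ⟨∅⟩
  have hZ : Matrix.partitionFn β (hamiltonianWith G t U μ) ≠ 0 :=
    (Matrix.partitionFn_pos β (isHermitian_hamiltonianWith G t U μ)).ne'
  rw [Matrix.thermalCorr, Matrix.gibbsState_apply,
    ← tsum_hubbardTruncatedCoeff_mul_partitionFn G β t U μ x y σ σ' hT, mul_comm _ (Matrix.partitionFn _ _),
    inv_mul_cancel_left₀ hZ]

/-- The `(0,0)` entry of the two-point propagator matrix is the free two-point function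
`⟨c†_{xσ}c_{yσ'}⟩₀ = [(1 + e^{βh})⁻¹]_{oy, ox}`. [folklore] -/
theorem twoPointPropMatrix_zero_zero (β : ℝ) (h : Matrix (Orb Λ) (Orb Λ) ℂ) (ox oy : Orb Λ) {k : ℕ}
    (f : Fin k → Λ) (s : Fin k → ℂ) :
    twoPointPropMatrix β h ox oy f s 0 0 = (1 + exp ((β : ℂ) • h))⁻¹ oy ox := by
  letI : NormedAlgebra ℚ (Matrix (Orb Λ) (Orb Λ) ℂ) := .restrictScalars ℚ ℂ _
  unfold twoPointPropMatrix propMatrix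
  simp [NormedSpace.exp_zero]

/-- **Order zero: the truncated coefficient `t₀` is the free two-point function**
`⟨c†_{xσ}c_{yσ'}⟩₀ = [(1 + e^{βh})⁻¹]_{(y,σ'),(x,σ)}` (the Fermi matrix of `FermionQuasiFree`; a check of
the conventions: one cluster, `𝓔ᵀ = 𝓔`, a `1 × 1` determinant). [folklore] -/
theorem hubbardTruncatedCoeff_zero (β t μ : ℝ) (x y : Λ) (σ σ' : Fin 2) :
    hubbardTruncatedCoeff G β t μ x y σ σ' 0 =
      (1 + exp ((β : ℂ) • hubbardOneBody G t μ))⁻¹ (orb y σ') (orb x σ) := by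
  unfold hubbardTruncatedCoeff truncatedIntegrand twoPointUrsell
  haveI hU : Unique (Fin (0 * 2 + 1)) := ⟨⟨0⟩, fun i => Fin.ext (by have := i.isLt; omega)⟩
  have hu : (Finset.univ : Finset (Option (Fin 0))) = {none} := Finset.univ_unique
  rw [orderedIntegral_zero, pow_zero, one_mul, Fintype.sum_unique, hu,
    Literature.Probability.LatticeModels.ursellOf_singleton, ← hu,
    FermionicTree.moment_univ, Matrix.det_unique]
  convert twoPointPropMatrix_zero_zero β (hubbardOneBody G t μ) (orb x σ) (orb y σ') _ _ using 2 <;>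
    exact Subsingleton.elim _ _

end Hubbard

/-! ### The two-point function of the tree's fact `bgm_two_point_limit` -/

section Torus

open Literature.Probability.LatticeModels

/-- **The linked-cluster series of the Hubbard two-point function on the torus** — the object of
the tree's fact `bgm_two_point_limit`: for `L ≠ 0`, whenever the truncated series converges
absolutely at `U`,
`⟨c†_{xσ}c_{yσ'}⟩_{β,L} = Σ_j U^j t_j(L)`, `t_j(L) = hubbardTruncatedCoeff (fermionTorusGraph 2 L) β 1 μ x̄ ȳ σ σ' j`.
Bounds on `t_j(L)` uniform in `L` (Gram–Hadamard / tree expansion, BGM 2006 (2.66), (2.77), and the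
renormalisation-group resummation of §2.2–§3) are what the thermodynamic limit requires; they are
not claimed here. [cite: BenfattoGiulianiMastropietro2006, §2.2 (2.14)-(2.16)] -/
theorem hubbardThermalTwoPoint_eq_tsum_truncated (β U μ : ℝ) {L : ℕ} [NeZero L] (x y : Site 2)
    (σ σ' : Fin 2)
    (hT : Summable fun j : ℕ => ‖(U : ℂ) ^ j *
      hubbardTruncatedCoeff (fermionTorusGraph 2 L) β 1 μ (FermionTorus.ofTorusSite (Torus.proj L x))
        (FermionTorus.ofTorusSite (Torus.proj L y)) σ σ' j‖) :
    hubbardThermalTwoPoint β U μ L x y σ σ' = ∑' j : ℕ, (U : ℂ) ^ j *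
      hubbardTruncatedCoeff (fermionTorusGraph 2 L) β 1 μ (FermionTorus.ofTorusSite (Torus.proj L x))
        (FermionTorus.ofTorusSite (Torus.proj L y)) σ σ' j := by
  have h := thermalCorr_hubbard_eq_tsum_truncated (fermionTorusGraph 2 L) β 1 U μ
    (FermionTorus.ofTorusSite (Torus.proj L x)) (FermionTorus.ofTorusSite (Torus.proj L y)) σ σ' hT
  unfold hubbardThermalTwoPoint
  rw [dif_neg (NeZero.ne L)]
  convert h using 2
  rw [hubbardTorusWith]

end Torus

end Literature.MathematicalPhysics.QuantumLattice

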